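import Summits.ResolutionOfSingularities.ResolutionOfSingularities.Theorems.RadicialJungCleanModelsStubCossartPiltant2019Lemma94OfInvariantCofinality
import HarnessLib

/-!
# `CleanModels`, stub 2 (F-02): `InvariantCofinality3 ⟹ CossartPiltant2008_prop93` — the named candidate statement of OURS implies the
# printed unramified push-down ([CoP1] Prop. 9.3), modulo stub 1 (CJS Thm. 1.4) and the proved principalization

OURS (decomp-res hand-1 g20; crux `stmt-ResolutionOfSingularities-15917`, stub 2 of `Cruxes/CleanModels/Lines/Sketch.lean` rev 35).  The
companion of `…Lemma94OfInvariantCofinality.lean`: there `InvariantCofinality3 ⟹ CossartPiltant2008_lemma94_kummerCore`; here the second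
printed push-down.  Proof = the tree's chain for Cossart–Piltant 2019 Prop. 4.10 read at the level of INSTANCES instead of the global
`CossartPiltant2019ReductionP`: the inertia layer (`inertLayer_descent_of_stableInertiaField`, [CoP1] Prop. 9.3 HAL p. 27) from a
`Gˢ`-stable local uniformization of the inertia field containing its henselian generator — which `InvariantCofinality3` supplies through
`equivariantLU_of_invariantCofinality` (second member, `hEqI`) and `exists_stableModel_of_stableLocalRing_decompositionGroup` — and the
decomposition layer ([CoP1] Prop. 9.3 for `K′ ≤ Kˢ`, HAL pp. 27–28: `exists_localUniformization_of_head'` ∘ `head_conclusion_of_monomialization`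
∘ `exists_monomialization_with_denominators`, all PROVED in the tree from principalization `CossartPiltant2019Principalization_holds` and
embedded resolution of surfaces in CJS Cor. 1.5 shape `CossartJannsenSaito2020Embedded.cor15`), glued by `unramifiedDescent_of_layers` with
cofinality `cofinality_of_principalization`.

* `prop93_of_stub1_of_invariantCofinality3 : CossartJannsenSaito2020Embedded.{0} → InvariantCofinality3.{0} → CossartPiltant2008_prop93.{0}`.

With `lemma94KummerCore_of_invariantCofinality3` this closes the square: `InvariantCofinality3` (+ stub 1) ⟹ BOTH printed push-downs ⟹ (with
CP 2019 Thm. 1.5, Hironaka at char 0) the type of stub 2.  Nothing here proves resolution of singularities in positive characteristic, local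
uniformization in dimension three, or any statement of a manuscript under adjudication; rung 0. AI-written; AI review weaker than expert review.
-/

-- `Summit.<Summit>.<Sub>.Theorems` with `Sub = Summit` (single-conjunct summit, D-0017)
set_option linter.dupNamespace false

noncomputable section

open IsLocalRing Polynomial AlgebraicGeometry
open _root_.IntermediateField
open Literature.AlgebraicGeometry.Resolution
open Summit.ResolutionOfSingularities.ResolutionOfSingularities.Theorems.CP2008Prop44

namespace Summit.ResolutionOfSingularities.ResolutionOfSingularities.Theorems.RadicialJung.CleanModels

section Tools

variable {S E : Type} [CommRing S] [Field E] [Algebra S E]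

/-- If `E` is algebraic over `S`, it is algebraic over every subfield `M ∋ S` (copy of the private tool of `ArithmeticalThreefoldsLocalDescentEquivariantSplit.lean`). [folklore] -/
private theorem isAlgebraic_subfield_of_isAlgebraic''' [Algebra.IsAlgebraic S E]
    (hinj : Function.Injective (algebraMap S E)) (M : Subfield E)
    (hSM : ∀ s : S, algebraMap S E s ∈ M) : Algebra.IsAlgebraic M E := by
  refine ⟨fun e => ?_⟩
  obtain ⟨q, hq0, hqe⟩ := Algebra.IsAlgebraic.isAlgebraic (R := S) e
  let f : S →+* M := (algebraMap S E).codRestrict M hSM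
  have hf : Function.Injective f := by
    intro a b hab
    apply hinj
    have h := congrArg (fun z : M => (z : E)) hab
    exact h
  have hcomp : (algebraMap M E).comp f = algebraMap S E := RingHom.ext fun _ => rfl
  refine ⟨q.map f, (Polynomial.map_ne_zero_iff hf).mpr hq0, ?_⟩
  rw [Polynomial.aeval_def, Polynomial.eval₂_map, hcomp]
  rwa [Polynomial.aeval_def] at hqe

/-- **Automorphisms of subextensions extend to the ambient algebraically closed field** (copy of the private tool of `ArithmeticalThreefoldsLocalDescentEquivariantSplit.lean`): for a subfield `M ∋ S` of `E` (algebraically closed, algebraic over `S`), an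
intermediate field `N | M` and `τ ∈ Aut_M(N)`, some `S`-automorphism `σ` of `E` restricts to `τ` on `N`. [folklore] -/
private theorem exists_algEquiv_extends_of_isAlgClosed''' [IsAlgClosed E] [Algebra.IsAlgebraic S E]
    (hinj : Function.Injective (algebraMap S E)) (M : Subfield E)
    (hSM : ∀ s : S, algebraMap S E s ∈ M) (N : IntermediateField M E) (τ : N ≃ₐ[M] N) :
    ∃ σ : E ≃ₐ[S] E, ∀ x : N, σ (x : E) = ((τ x : N) : E) := by
  haveI : Algebra.IsAlgebraic M E := isAlgebraic_subfield_of_isAlgebraic''' hinj M hSM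
  haveI : IsAlgClosure M E :=
    { isAlgClosed := ‹IsAlgClosed E›, isAlgebraic := ‹Algebra.IsAlgebraic M E› }
  haveI : Normal M E := IsAlgClosure.normal M E
  let σ₀ : E ≃ₐ[M] E := τ.liftNormal E
  have hσ₀S : ∀ s : S, σ₀.toRingEquiv (algebraMap S E s) = algebraMap S E s := fun s =>
    σ₀.commutes (⟨algebraMap S E s, hSM s⟩ : M)
  refine ⟨AlgEquiv.ofRingEquiv hσ₀S, fun x => ?_⟩
  exact AlgEquiv.liftNormal_commutes τ E x

end Tools

set_option maxHeartbeats 800000 in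
/-- **`InvariantCofinality3 ⟹ CossartPiltant2008_prop93` (modulo stub 1).**  For `M ≤ K′ ≤ Mⁱ` and a local uniformization of `K′`:
`unramifiedDescent_of_layers` with (a) cofinality from `CossartPiltant2019Principalization_holds`; (b) the decomposition layer
(`K′ ≤ Mˢ ⇒ LU M`) from `exists_localUniformization_of_head'`, `head_conclusion_of_monomialization`, `exists_monomialization_with_denominators`
(embedded resolution `CossartJannsenSaito2020Embedded.cor15`); (c) the inertia layer from `inertLayer_descent_of_stableInertiaField`, whose
stable-model input is produced from `InvariantCofinality3` — the henselian generator `η` of `Mⁱ = Mˢ(η)` (`exists_henselRoot_toSubfield_inertiaField_eq`),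
the `Gˢ`-stable local uniformization of `Mⁱ` containing `η` (`equivariantLU_of_invariantCofinality`, member `hEqI`), the stable MODEL
(`exists_stableModel_of_stableLocalRing_decompositionGroup`) and the unit-displacement clause (`valuation_map_sub_eq_one_of_henselRoot_inertiaField`).
[cite: CossartPiltant2008, Prop. 9.3 and its proof (HAL hal-00139124 pp. 26–28)] [cite: CossartPiltant2019, Props. 4.3, 4.4 and proof of Prop. 4.10 (arXiv v1 Props. 4.2, 4.3, 4.8)]
[cite: CossartJannsenSaito2020, Thm. 1.4, Cor. 1.5] -/
theorem prop93_of_stub1_of_invariantCofinality3 (hCJSE : CossartJannsenSaito2020Embedded.{0})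
    (hICof : InvariantCofinality3.{0}) : CossartPiltant2008_prop93.{0} := by
  intro p hp S _ _ _ hS hSdim hSchar hScomp E _ _ hinj hE halg OE hSO hdom hres hrk M hSM N _ _ K' hMK'
    hK'i hLUK'
  classical
  haveI := hE
  haveI := halg
  have h44 : CossartPiltant2019Principalization.{0} := CossartPiltant2019Principalization_holds
  have hEmb := CossartJannsenSaito2020Embedded.cor15 hCJSE
  have hEqI := (equivariantLU_of_invariantCofinality hICof).2
  refine unramifiedDescent_of_layers OE
    (cofinality_of_principalization h44 p hp S hS hSdim hSchar hScomp E hinj hE halg OE hSO hdom hres)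
    ?_ ?_ M hSM N K' hMK' hK'i hLUK'
  · -- decomposition layer: [CoP1] Prop. 9.3 for `K′ ≤ Mˢ`, proved in the tree
    intro M' hSM' N' _ _ K'' hMK'' hK''Z hLUK''
    exact exists_localUniformization_of_head' hS hinj hScomp OE hSO hdom hres M' hSM' N' K'' hMK'' hK''Z
      hLUK''
      (fun t₁ ht₁M _ ht₁O _ t₁' ht₁'K' hext₁ =>
        head_conclusion_of_monomialization h44 hEmb hS hSdim hinj OE hSO hdom hres hrk M' K'' hSM' hMK''
          hLUK'' t₁ ht₁M ht₁O t₁' ht₁'K' hext₁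
          (fun t htK' hTO hreg G hG hG0 hvG =>
            exists_monomialization_with_denominators hEmb hS hSdim hinj OE hSO hdom hres K''
              (fun s => hMK'' (hSM' s)) t htK' hTO hreg G hG hG0 hvG))
  · -- inertia layer: from a `Gˢ`-stable local uniformization of `Mⁱ` containing the henselian generator
    intro M' hSM' N' _ _ K'' hsK'' hK''i hLUK''
    refine inertLayer_descent_of_stableInertiaField OE
      (cofinality_of_principalization h44 p hp S hS hSdim hSchar hScomp E hinj hE halg OE hSO hdom hres)
      ?_ M' hSM' N' K'' hsK'' hK''i hLUK''
    intro M'' hSM'' N'' _ _ hLUI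
    -- the henselian generator of the inertia field
    obtain ⟨η, hηV, hηI, hF, hgen⟩ := exists_henselRoot_toSubfield_inertiaField_eq OE N''
    -- the group of `S`-automorphisms of `E` restricting to `Gˢ` on `N''`
    set Mi : Subfield E := (lift (fixedField (inertiaGroupIn OE N''))).toSubfield with hMidef
    have hMiN : ∀ x ∈ Mi, x ∈ N'' := fun x hx => lift_le _ (show x ∈ lift _ from hx)
    have hηN : η ∈ N'' := hMiN η hηI
    have hSMi : ∀ s : S, algebraMap S E s ∈ Mi := fun s => le_lift_toSubfield _ (hSM'' s)
    let H : Subgroup (E ≃ₐ[S] E) :=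
      { carrier := {σ | ∃ τ ∈ decompositionGroupIn OE N'', ∀ x : N'', σ (x : E) = ((τ x : N'') : E)}
        one_mem' := ⟨1, one_mem _, fun x => rfl⟩
        mul_mem' := by
          rintro σ₁ σ₂ ⟨τ₁, hτ₁, h₁⟩ ⟨τ₂, hτ₂, h₂⟩
          refine ⟨τ₁ * τ₂, mul_mem hτ₁ hτ₂, fun x => ?_⟩
          rw [AlgEquiv.mul_apply, AlgEquiv.mul_apply, h₂ x, h₁ (τ₂ x)]
        inv_mem' := by
          rintro σ ⟨τ, hτ, h⟩
          refine ⟨τ⁻¹, inv_mem hτ, fun x => ?_⟩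
          rw [AlgEquiv.aut_inv, AlgEquiv.aut_inv, AlgEquiv.symm_apply_eq, h (τ.symm x),
            AlgEquiv.apply_symm_apply] }
    have hH1 : ∀ σ ∈ H, ∀ x ∈ Mi, σ x ∈ Mi := by
      rintro σ ⟨τ, hτs, hτ⟩ x hx
      rw [hτ ⟨x, hMiN x hx⟩]
      exact map_mem_inertiaField_of_mem_decompositionGroupIn OE N'' hx hτs
    have hH2 : ∀ σ ∈ H, ∀ x ∈ Mi, x ∈ OE → σ x ∈ OE := by
      rintro σ ⟨τ, hτs, hτ⟩ x hx hxO
      rw [hτ ⟨x, hMiN x hx⟩]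
      exact (((mem_decompositionGroupIn_iff OE N'' τ).mp hτs) ⟨x, hMiN x hx⟩).mp hxO
    have hH3 : ∀ σ ∈ H, (∃ x ∈ Mi, σ x ≠ x) →
        ∃ x ∈ Mi, OE.valuation x = 1 ∧ OE.valuation (σ x - x) = 1 := by
      obtain ⟨F, hFmon, hFcoeff, hFη, hF'⟩ := hF
      rintro σ ⟨τ, hτs, hτ⟩ ⟨x, hx, hne⟩
      have hτi : τ ∉ inertiaGroupIn OE N'' := by
        intro hτi
        apply hne
        rw [hτ ⟨x, hMiN x hx⟩]
        have hxfix : (⟨x, hMiN x hx⟩ : N'') ∈ fixedField (inertiaGroupIn OE N'') :=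
          (IntermediateField.mem_lift (⟨x, hMiN x hx⟩ : N'')).mp hx
        exact congrArg Subtype.val ((mem_fixedField_iff _ _).mp hxfix τ hτi)
      have hunit := valuation_map_sub_eq_one_of_henselRoot_inertiaField OE N'' hηV hηN F hFmon
        hFcoeff hFη hF' hgen hτs hτi
      by_cases hvη : OE.valuation η = 1
      · refine ⟨η, hηI, hvη, ?_⟩
        rw [hτ ⟨η, hηN⟩, hunit]
      · have hlt : OE.valuation η < 1 :=
          lt_of_le_of_ne ((OE.valuation_le_one_iff η).mpr hηV) hvη
        have h1η : OE.valuation (1 + η) = 1 := Valuation.map_one_add_of_lt _ hlt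
        refine ⟨1 + η, add_mem (one_mem _) hηI, h1η, ?_⟩
        rw [map_add, map_one, hτ ⟨η, hηN⟩,
          show (1 : E) + ((τ ⟨η, hηN⟩ : N'') : E) - (1 + η) = ((τ ⟨η, hηN⟩ : N'') : E) - η by ring,
          hunit]
    obtain ⟨t, htK, hKle, hTO, hreg, hstab, hηt⟩ := hEqI p hp S hS hSdim hSchar hScomp E hinj
      hE halg OE hSO hdom hres hrk Mi hSMi H hH1 hH2 hH3 η hηI hηV hLUI
    -- stability of the local ring under every `τ ∈ Gˢ`, through an extension of `τ` to `E`
    have hstabτ : ∀ τ ∈ decompositionGroupIn OE N'', ∀ x : N'',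
        (x : E) ∈ locAtCentre (Algebra.adjoin S (t : Set E)).toSubring OE →
        ((τ x : N'') : E) ∈ locAtCentre (Algebra.adjoin S (t : Set E)).toSubring OE := by
      intro τ hτs x hx
      obtain ⟨σ, hσ⟩ := exists_algEquiv_extends_of_isAlgClosed''' hinj M'' hSM'' N'' τ
      have hσH : σ ∈ H := ⟨τ, hτs, hσ⟩
      rw [← hσ x]
      exact hstab σ hσH _ hx
    obtain ⟨F, hFmon, hFcoeff, hFη, hF'⟩ := hF
    refine exists_stableModel_of_stableLocalRing_decompositionGroup OE M'' N'' t htK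
      (lift (fixedField (decompositionGroupIn OE N''))).toSubfield
      ((lift_fixedField_toSubfield_mono (inertiaGroupIn_le_decompositionGroupIn OE N'')).trans
        hKle) hTO hreg hstabτ ?_
    intro τ hτ
    by_cases hτi : τ ∈ inertiaGroupIn OE N''
    · exact Or.inl hτi
    · exact Or.inr ⟨⟨η, hηN⟩, hηt,
        valuation_map_sub_eq_one_of_henselRoot_inertiaField OE N'' hηV hηN F hFmon hFcoeff hFη
          hF' hgen hτ hτi⟩

end Summit.ResolutionOfSingularities.ResolutionOfSingularities.Theorems.RadicialJung.CleanModels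

end
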